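import Summits.HodgeConjecture.HodgeConjecture.Cruxes.H413.Lines.F0_U3LettersRung1Defs   -- 0 sorry: `SpecOverride` :151 ∕ `ComparisonKit.override` :185 ∕ `SpecPkgT1` :190 (the A↔B junction currency); imports T1 MAIN :1, T1-API :21, T1-Nonreg :42 (★ `IsPinned.ellipticStabilisation`)
import Summits.HodgeConjecture.HodgeConjecture.Cruxes.H413.Lines.R90_S6_StableTFSpectralB     -- ED. 2 (L9: A imports B; B never imports A): FILE B's (14.5.1) engine heads `mTermCancellationSm_of_dichotomy[_of_T1b∕_S6]`, `HeckeDichotomyOv`, `LanglandsDichotomy` (+ socket `sock_S6_langlandsDichotomy`)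
import HarnessLib

/-!
# R90-TF S6 «Ch. 14.1–14.5 stable trace formula», FILE A — GEOMETRIC SIDE §14.1–14.5 (a) BY NAME + the A→B junction (ED. 1)
# (Rogawski 1990, Annals of Math. Studies 123: §14.1–14.2 pp. 232–233, §14.3 pp. 233–234, §14.4 Props. 14.4.1–14.4.2 pp. 235–236,
# §14.5 Thm. 14.5.1 (a)(b) + Lemma 14.5.2 pp. 237–241)

Cell `hodgecm-mathlib`, crux H413 = `stmt-HodgeConjecture-24833` (`HCCMUnconditional.H413`); R90-TF section S6 (LEAD R90-C14-plan (g0)), typist R90-C14-typ1 (g0),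
DEAL v0 (R90 bus 2026-09-04T15:06:51Z) → HEADS-A.v1 (`R90/R90-C14-typ1/g0/HEADS-A.v1.md` 2dc0b2673e15b19a) → AUDIT S6-A0 (15:09:09Z) → DEAL v1 (15:12:40Z: R1 (A1)
WITHDRAWN, R2 (G5) home = A, R3 Defs import) → DEAL v1.1 (15:13:42Z: SMOOTH GUARD texts `QuasiSplitStableTFSm` ∕ `MTermCancellationSm` + `thm1451bSm_override`; B7 bridge = A ED. 2).  S-layer = STATEMENT layer; this file proves nothing new about the
trace formula: every head below is a COMPOSITION BY NAME of ★ declarations (no restatement, programme law C4), and ED. 1 carries **0 `sorry`**.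
Namespace `Summit.HodgeConjecture.HodgeConjecture.R90.S6` (brief v2 §3 rule 4).

## What §14.1–14.5 (a) IS in the tree (FINDING S6-F1 of the LEAD; HEADS-A.v1 FINDING A-F1), cited BY NAME — nothing re-socketed
* §14.1–14.2 the comparison data `(G′ = U(H), G = U(Φ₃), H = U(Φ₂) × U(Φ₁), ψ_v, f′ ↦ f, f′ ↦ f′^H)` = the POSITED kit ★ `ComparisonKit L H μ` (T1-Kit :159) with its
  concrete anchors ★ `ComparisonKit.IsPinned` (T1-Kit :745); law names T1a–T1g (T1-Kit §2 :916–:961), `Thm1451b` (:977), ★ `thm1451b_of_laws` (:998: T1a–T1d ⇒ 14.5.1 (b)).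
* T1a [§14.5 pp. 237–238, `θ_{G′} = J_{G′}` for compact quotient] = ★ `AnchorWitness.simpleTraceFormula` (T1 MAIN :1383); T1g [§14.2–14.3] = ★ `.transferExistence` (:1375).
* T1b = Thm. 14.5.1 (a) + Lemma 14.5.2 [pp. 238–241] for EVERY pinned kit = ★ `ComparisonKit.IsPinned.ellipticStabilisation` (T1-Nonreg :1236, 0 sorry) — USED BY NAME in
  (G3)∕(G4)∕(G4′) below; NO alias is declared (AUDIT S6-A0 (A2): a re-bound alias would be a restatement, C4).
* Prop. 14.4.1 p. 235 = ★ AGG row `stub_N8` (`F0_U3LettersRung1.lean` :153, `:= stub_N8_paid`, `ArchInnerTransferCompatible`); Prop. 14.4.2 p. 236 = ★ `stub_N9` (:163,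
  `:= stub_N9_paid`, `ArchEndoscopicTransferCompatible … (archExplicitTransferFactor …)`).
* The transfer inputs of §14.2–14.3 (the hypotheses `hGT ∕ hAT₄ ∕ hSET` of ★ `engineT1_of_stubs`, T1 MAIN :1695) are, AT THE LETTERS' FRAME, ★ modulo ONE registered leaf:
  ★ `F0P3Rung0OfLettersNormalisedPinned.rung0Data_of_letters_normalisedPinned` (Theorems, :95: `hAT₄` := ★ `archTransfersExistCanonical_of_stubs`, `hSET` := ★
  `singularEllipticTransferCanonical_of_stubs` ← ★ `stub_S1nR`, `hGTQ` := ★ `globalTransferPackageAnd_of_stubs` ← N6 ⟸ `stub_N6ns` ⟸ `stub_N6nsDyadic` (AGG :197, LEAF L3))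
  → KitRung0 `rung0_of_letters_pinned` (:346) → AGG `rung0_pinned` (:458) → `nonempty_rung0ChoicePinned` (:501).  CITED, NOT IMPORTED (the closer carries `sorry`; Defs-road
  import topology).  EXTERNAL-INPUTS LEDGER (print citation → tree status): [BR₁] fundamental lemma (Prop. 4.9.1 (b) p. 55 «It is proved in [BR₁]») → ★ N7
  `UnitFundamentalLemmaExplicitClosed` + the N6 chain, residual = LEAF L3 `N6nsDyadicStatement` = the architect's INDEX-ONLY edge «S6.ext := AGG :197 `stub_N6nsDyadic` (L3)» (registered AGG row; not re-socketed here, C1); [LS] transfer factors → ★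
  `globalTransferCartanKappa_pointed_of_stubs`; [Kt₆] Prop. 2 → ★ (S-c) `archTransfersSingularOfCanonicalClosed_of_centralVanishing` + §14.3 chain; [A₂] Arthur's trace formula
  (10.2.1)∕(10.2.2) for the quasi-split `G`, `H` → FILE B ∕ S8 (SCOPE ASK of the LEAD, 15:06:51Z).
  NOT TYPED (HEADS-A.v1 FINDING A-F1): ∀-closed `sock_S6_ext_transfer_*` — over `Tinf : ArchTransferFactor L H` = bare `TransferFactorData` (zero factor included, ★
  `not_isArchNondegenerate_zero`) they are false at junk data, and at the frame they restate the ★ chain above.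

## What this file TYPES (ED. 1; two named TEXTS (`def … : Prop`, parameters `𝔨`, `ov`; nothing asserted) + heads all PROVED BY NAME, 0 `sorry`)
* (T-c) `QuasiSplitStableTFSm 𝔨 ov` — T1c's body (T1-Kit :934–:938) with `𝔨.Sθ* ↦ ov.Sθ*` and the SMOOTH GUARD `𝔨.Smooth f' →` in the binder shape of organ O1″ row (T)
  (DEAL v1.1: the (14.5.1) engine's inputs are only ever available for smooth `f′`): `SJ_G(f) = Sθ_G(f) + Sθ_M(f) − SJ_M(f)`, `SJ_H(f^H) = Sθ_H(f^H) + Sθ_{M_H}(f^H) − SJ_{M_H}(f^H)`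
  [(5.2.3) p. 70 ∕ (10.2.3) p. 157 for `G`; Prop. 11.2.1 context for `H`; p. 240].
* (T-d) `MTermCancellationSm 𝔨 ov` — T1d's body (T1-Kit :940–:944) likewise: `[Sθ_M(f) + ½ Sθ_{M_H}(f^H)] − [SJ_M(f) + ½ SJ_{M_H}(f^H)] = 0` [(14.5.1) p. 240; Cor. 9.3.4; Prop. 9.4.2].
  (`quasiSplitStableTFSm_of_laws` ∕ `mTermCancellationSm_of_laws`: the kit laws at `𝔨.override ov` imply the guarded texts — one-liners.)
* (G2) `isPinned_override_iff` — `IsPinned` is invariant under the spectral override ★ `ComparisonKit.override` (Defs :185): `IsPinned` names none of the twelve overridden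
  fields `SθG SθH SθM SJM SθMH SJMH PacketG PacketH nG nH trG trH`; `Iff.rfl`.  (The lemma DEAL v0 (B4) tells FILE B to expect.) [§14.6 p. 241; Defs §A.1]
* (G2′) `override_SJGtot ∕ override_SJHtot ∕ override_SθG ∕ override_SθH ∕ override_matches_iff` — the `rfl` transport of the `J ∕ SJ`-side totals and of `Matches` (untouched
  fields) and of the two `Sθ` heads (overridden fields), for FILE B and S7 to rewrite with. [p. 240]
* (G3) `thm1451a_override` — T1b for the overridden kit of a pinned kit (★ `override_ellipticStabilisation_iff` Defs :210 + ★ `IsPinned.ellipticStabilisation` by name). [Thm. 14.5.1 (a)]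
* (G4) JUNCTION A→B `thm1451b_override_of_stableTF` — [Thm. 14.5.1 (b) p. 238; proof p. 240]: for a pinned kit with T1a, the overridden kit's T1c
  `QuasiSplitStableTraceFormulas` ((5.2.3)∕(10.2.3) for `G` and `H`, p. 240 (end of the proof of Thm. 14.5.1)) and T1d `MTermCancellation` ((14.5.1) p. 240) give
  `(𝔨.override ov).Thm1451b` — ★ `thm1451b_of_laws` at the override, T1a∕T1b transported by ★ `override_simpleTraceFormula_iff` ∕ (G3).  FILE B's TOP `thm1451b_of_S6` is
  `:= thm1451b_override_of_stableTF …` over its sockets (B1)(B2)(B3); B never re-derives T1b.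
* (G4′) `thm1451bSm_override` — DEAL v1.1: for a pinned kit with T1a, `QuasiSplitStableTFSm 𝔨 ov → MTermCancellationSm 𝔨 ov → ∀ f′ f f^H, 𝔨.Smooth f′ → 𝔨.Matches f′ f f^H →
  θ_{G′}(f′) = Sθ_G(f) + ½ Sθ_H(f^H)` — PROVED by the algebra of ★ `thm1451b_of_laws` (T1-Kit :998–:1008) with T1b ★ `IsPinned.ellipticStabilisation` at `𝔨`. [Thm. 14.5.1 (b) p. 238]
* (G5) S7-CURRENCY COROLLARY `sjTot_eq_sTheta_override` — `QuasiSplitStableTFSm 𝔨 ov → MTermCancellationSm 𝔨 ov →` for every SMOOTH `f′` and matching `(f, f^H)`,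
  `𝔨.SJGtot f + (1 / 2 : ℂ) * 𝔨.SJHtot fH = ov.SθG f + (1 / 2 : ℂ) * ov.SθH fH` — PURE REARRANGEMENT (no pin, no T1a, no T1b); binder shape and LHS bytes = organ O1″
  `PKtupleBaseLetterK2μ` row (T) (`F0_P3c_PKtuplePaydown.lean` :215: `(f' : …TestGp L H) (f : …TestG L) (fH : …TestH L), 𝔨.Smooth f' → 𝔨.Matches f' f fH → … 𝔨.SJGtot f + (1 / 2 : ℂ) * 𝔨.SJHtot fH = …`;
  the V6 and T1-Kit `TestGp∕TestG∕TestH` are the same `abbrev` body `CompactlySupportedContinuousMap (cmDatum L 3 _).Adelic ℂ`).  `sjTot_eq_sTheta_override_of_laws`: the same from the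
  unguarded kit laws at the override. [p. 240: «SJ_G(f) + ½ SJ_H(f^H) = Sθ_G(f) + ½ Sθ_H(f^H) + (14.5.1), and (14.5.1) = 0»]
* S6 TOP (ED. 2, NOT HERE): instantiation at S8-A's CM override `ov_cm` + the B7 bridge `mTermCancellationSm 𝔨 ov_cm` from FILE B's (14.5.1) engine — «WAITS ON S8-A `ov_cm` ∕ E-S5-def»
  (LEAD #9 (1), L8 (iii), L9: A imports S8-A + B at ED. 2; B never imports A).

## ED. 3 § «ARTHUR-SIMPLE OVERRIDE» (Q-S1 of record R-QS1-1…7; LEAD #30 (D); R90-C14-plan DEAL 22:00:30Z (6) + SHEET 22:03:33Z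
## `R90/R90-C14-plan/g0/S6_A_ed3_arthurSimple.v1.R90-C14-plan-g0.lean` b7edd0e2f4f4076e, whose body ll. 26–176 is §AS below VERBATIM; ADDITIONS ONLY — every ED. 2 statement is byte-frozen)
Two-place edition: on the h413 path every transfer `f`, `f^H` of a `G′`-function is CUSPIDAL at ≥ 2 (archimedean) places, and print's proof of Thm. 14.5.1 then runs with NO
`M`-terms — p. 240 L1 «If `v ∈ S₀ ∪ S`, then `Φ^M(γ, f_v) ≡ 0` and hence `Φ^M(γ, f) ≡ 0`»: `Sθ_M`, `SJ_M`, `Sθ_{M_H}`, `SJ_{M_H}` vanish on transfers and (5.2.3)∕(10.2.3) read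
`SJ_G(f) = Sθ_G(f)`, `SJ_H(f^H) = Sθ_H(f^H)` (p. 240, the two displayed lines before (14.5.1)).  The GENERIC constructor (AS0) `arthurSimpleOverride 𝔨 PacketG PacketH nG nH trG trH :
SpecOverride L` (namespace `R90.S6`; DATA ONLY) records exactly this: `SθG := 𝔨.SJGtot`, `SθH := 𝔨.SJHtot`, the four `M`-fields `:= 0`, the packet six as given (+ 10 `rfl` `@[simp]`
read-backs `arthurSimpleOverride_SθG ∕ _SθH ∕ _SθM ∕ _SJM ∕ _SθMH ∕ _SJMH ∕ _nG ∕ _nH ∕ _trG ∕ _trH`); its instance of record `ov_cm` at S8's packet six is S8-A ED. 4's pen (J-S6-S8-3;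
no S5∕S8 import here).  AT THIS OVERRIDE, all PROVED with 0 `sorry`:
* (AS1) `quasiSplitStableTraceFormulas_arthurSimple` — T1c there is an identity of the edition (`SJ_G = SJ_G + 0 − 0`, `simp`); (AS2) `mTermCancellation_arthurSimple` — T1d there
  = (14.5.1) two-place edition, `0 − 0 = 0`.
* (AS3) `thm1451b_arthurSimple (ha : 𝔨.SimpleTraceFormula) (hb : 𝔨.EllipticStabilisation)` — Thm. 14.5.1 (b) at the override from T1a + T1b ALONE (★ `thm1451b_of_laws` there, pin-free);
  (AS3-pinned) `thm1451b_arthurSimple_pinned` — the same for a PINNED kit with T1a, T1b discharged by ★ `IsPinned.ellipticStabilisation` via (G4) `thm1451b_override_of_stableTF`.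
* (AS4)∕(AS5) READ-BACKS (`Iff.rfl`) `stableSpectralExpansionG_arthurSimple_iff` ∕ `stableSpectralExpansionH_arthurSimple_iff`: T1e∕T1f AT THE OVERRIDE are the two ON-PATH spectral
  sockets «∀ smooth `f′`, ∀ transfer `f`: `Summable (fun P => nG P * trG P f)` ∧ `𝔨.SJGtot f = ∑' P, nG P * trG P f`» (resp. `H`: `TransferH`, `SJHtot`) — the Arthur-simple stable trace
  formula with the elliptic stabilisation and the packet regrouping INSIDE its payment (S8's sockets at `ov_cm`, stated at the kit-of-record tuple, never `∀ 𝔨`).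
* (AS6) `specPkgT1_arthurSimple (he) (hf)`, (AS7) `lawsT1_arthurSimple (ha) (hb) (hg) (he) (hf)` — ★ `SpecPkgT1` ∕ ★ `LawsT1` at the override from T1a, T1b, T1g at `𝔨` + the two sockets.
* (AS8) `innerFormStableTraceIdentity_arthurSimple (ha) (hb) (hg) (he) (hf)` — (14.6.1) = ★ T1-Kit head `InnerFormStableTraceIdentity` AT THE OVERRIDE (★ `innerFormStableTraceIdentity_of_laws`
  there); (AS8′) `traceGp_eq_spec_arthurSimple` — the same UNFOLDED: `𝔨.traceGp f' = (∑' P, nG P * trG P f) + ½ ∑' r, nH r * trH r fH` with both sums summable.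
* (AS9) `traceGp_eq_sjTot_pinned` — THE S9∕S7 CURRENCY HEAD ON PATH: for a pinned kit with T1a, `∀ f′ f f^H, 𝔨.Smooth f′ → 𝔨.Matches f′ f f^H → 𝔨.traceGp f′ = 𝔨.SJGtot f + ½ 𝔨.SJHtot f^H`
  (T1a then ★ `IsPinned.ellipticStabilisation`; no `ov`, no T1c–T1f) = the payment of S9's `sock_S9_thm1451b_cm` and of S7's organ O1″ row (T) at the Arthur-simple pair.
WHY NOT COSTUME (C4 self-check, planner 22:00:30Z (6)): the letters that go trivial (T1c, T1d) are exactly the ones Q-S1 replaces by vanishing; the trace-formula content rides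
UNDIMINISHED and non-vacuous on T1e∕T1f at the override (one socket per group); an override models print ON TRANSFERS — the only place any law reads it; off transfers its values are
conventional, as for every override.  Imports UNCHANGED. [Rogawski1990 §14.5 p. 240 L1–L12, (14.5.1) pp. 240–241; Thm. 14.6.1 p. 241; §14.6 p. 242; Arthur1988InvariantTraceFormulaII §7 Cor. 7.2–7.4 pp. 539–540]

HONEST LABEL: HC_CM is proved only modulo the 7 printed citations (2 remaining named inputs: hLiu418 = stmt-HodgeConjecture-24832, h413 = stmt-HodgeConjecture-24833)
— DISTANCE TO ZERO: citations 3 ∕ leaves 7 (closable 3 · S-layer 4+) ∕ axioms 0 — until rung 0 closes.  This file discharges no stub and registers no row.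

References: [Rogawski1990] J. D. Rogawski, Automorphic Representations of Unitary Groups in Three Variables, Ann. of Math. Stud. 123 (1990), §14.1–14.5 pp. 232–241,
§4.9 Prop. 4.9.1 p. 55, §5.2 (5.2.3) p. 70, §10.2 (10.2.3) p. 157; [LanglandsShelstad1987] §6.4; [Kottwitz1988] Thm. 1, Prop. 2; [BlasiusRogawski1992] ([BR₁]).
-/

set_option autoImplicit false
set_option linter.dupNamespace false

noncomputable section

open MeasureTheory Measure NumberField IsDedekindDomain
open scoped Matrix

namespace Summit.HodgeConjecture.HodgeConjecture.R90.S6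

open Literature.NumberTheory.Automorphic
open Summit.HodgeConjecture.HodgeConjecture.Cruxes.H413.F0T1InnerFormTraceIdentity

variable {L : Type} [Field L] [NumberField L] [IsCMField L] {H : Matrix (Fin 3) (Fin 3) L}
  {μ : Measure (UnitaryGroup.cmDatum L 3 H).automorphicQuotient} [(UnitaryGroup.cmDatum L 3 H).IsAutomorphicMeasure μ]

/-! ## §G2′ The `rfl` transport under the spectral override (untouched `J ∕ SJ` side; overridden `Sθ` heads) [Rogawski1990, p. 240] -/

section Transport

variable (𝔨 : ComparisonKit L H μ) (ov : SpecOverride L)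

/-- `SJ_G` is untouched by the override. [cite: Rogawski1990, §14.5 p. 240] -/
@[simp] theorem override_SJGtot : (𝔨.override ov).SJGtot = 𝔨.SJGtot := rfl

/-- `SJ_H` is untouched by the override. [cite: Rogawski1990, §14.5 p. 240] -/
@[simp] theorem override_SJHtot : (𝔨.override ov).SJHtot = 𝔨.SJHtot := rfl

/-- `J_{G′}` is untouched by the override. [cite: Rogawski1990, §14.5 pp. 237–238] -/
@[simp] theorem override_JGp : (𝔨.override ov).JGp = 𝔨.JGp := rfl

/-- `Sθ_G` of the overridden kit is the override's. [cite: Rogawski1990, §14.5 p. 240] -/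
@[simp] theorem override_SθG : (𝔨.override ov).SθG = ov.SθG := rfl

/-- `Sθ_H` of the overridden kit is the override's. [cite: Rogawski1990, §14.5 p. 240] -/
@[simp] theorem override_SθH : (𝔨.override ov).SθH = ov.SθH := rfl

/-- `Sθ_M`, `SJ_M`, `Sθ_{M_H}`, `SJ_{M_H}` of the overridden kit are the override's. [cite: Rogawski1990, §14.5 (14.5.1) p. 240] -/
theorem override_MTerms : (𝔨.override ov).SθM = ov.SθM ∧ (𝔨.override ov).SJM = ov.SJM ∧ (𝔨.override ov).SθMH = ov.SθMH ∧ (𝔨.override ov).SJMH = ov.SJMH :=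
  ⟨rfl, rfl, rfl, rfl⟩

/-- Matching triples are untouched by the override (`Transfer`, `TransferH` are not spectral sockets). [cite: Rogawski1990, §14.2–14.3 pp. 232–234] -/
theorem override_matches_iff (f' : TestGp L H) (f : TestG L) (fH : TestH L) : (𝔨.override ov).Matches f' f fH ↔ 𝔨.Matches f' f fH := Iff.rfl

/-- `Thm1451b` of the overridden kit, unfolded to the kit's trace and the override's `Sθ` heads. [cite: Rogawski1990, Thm. 14.5.1 (b) p. 238] -/
theorem override_thm1451b_iff :
    (𝔨.override ov).Thm1451b ↔
      ∀ (f' : TestGp L H) (f : TestG L) (fH : TestH L), 𝔨.Matches f' f fH → 𝔨.traceGp f' = ov.SθG f + (1 / 2 : ℂ) * ov.SθH fH :=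
  Iff.rfl

/-! ## §T The two SMOOTH-GUARDED TEXTS of §14.5 (b) at an override (DEAL v1.1) — `def`s with parameters, nothing asserted [Rogawski1990, p. 240] -/

/-- **(T-c) [Rogawski1990, §14.5 p. 240; (5.2.3) p. 70, (10.2.3) p. 157, Thm. 10.3.1; Prop. 11.2.1]** the stabilised trace formulas of the quasi-split `G = U(Φ₃)` and
`H = U(Φ₂) × U(Φ₁)` READ AT THE OVERRIDE `ov`, for transfers of SMOOTH `G′`-functions: `SJ_G(f) = Sθ_G(f) + Sθ_M(f) − SJ_M(f)` and `SJ_H(f^H) = Sθ_H(f^H) + Sθ_{M_H}(f^H) − SJ_{M_H}(f^H)`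
— T1c's body (T1-Kit `QuasiSplitStableTraceFormulas` :934–:938) with `𝔨.Sθ* ↦ ov.Sθ*` and the guard `𝔨.Smooth f' →` (organ O1″ row (T) binder shape).
[cite: Rogawski1990, §14.5 p. 240; §5.2 (5.2.3) p. 70; §10.2 (10.2.3) p. 157; Thm. 10.3.1 p. 160; Prop. 11.2.1] -/
def QuasiSplitStableTFSm (𝔨 : ComparisonKit L H μ) (ov : SpecOverride L) : Prop :=
  ∀ (f' : TestGp L H) (f : TestG L) (fH : TestH L), 𝔨.Smooth f' → 𝔨.Matches f' f fH →
    𝔨.SJGtot f = ov.SθG f + ov.SθM f - ov.SJM f ∧ 𝔨.SJHtot fH = ov.SθH fH + ov.SθMH fH - ov.SJMH fH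

/-- **(T-d) [Rogawski1990, §14.5 (14.5.1) p. 240; Cor. 9.3.4; Prop. 9.4.2]** cancellation of the `M`-terms READ AT THE OVERRIDE `ov`, for transfers of SMOOTH `G′`-functions:
`[Sθ_M(f) + ½ Sθ_{M_H}(f^H)] − [SJ_M(f) + ½ SJ_{M_H}(f^H)] = 0` — T1d's body (T1-Kit `MTermCancellation` :940–:944) with `𝔨.Sθ* ↦ ov.Sθ*` and the guard `𝔨.Smooth f' →`
(print's proof uses that `f` is a transfer from the ANISOTROPIC `G′`, `S₀ ≠ ∅`: «Φ^M(γ, f_v) ≡ 0 for v ∈ S₀ ∪ S», pp. 239–240 — hence the matching hypothesis stays).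
[cite: Rogawski1990, §14.5 (14.5.1) p. 240; Cor. 9.3.4; Prop. 9.4.2] -/
def MTermCancellationSm (𝔨 : ComparisonKit L H μ) (ov : SpecOverride L) : Prop :=
  ∀ (f' : TestGp L H) (f : TestG L) (fH : TestH L), 𝔨.Smooth f' → 𝔨.Matches f' f fH →
    (ov.SθM f + (1 / 2 : ℂ) * ov.SθMH fH) - (ov.SJM f + (1 / 2 : ℂ) * ov.SJMH fH) = 0

/-- The kit law T1c at `𝔨.override ov` implies the guarded text (drop the guard; `rfl` transport of the untouched `SJ` totals). [cite: Rogawski1990, §14.5 p. 240] -/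
theorem quasiSplitStableTFSm_of_laws (hc : (𝔨.override ov).QuasiSplitStableTraceFormulas) : QuasiSplitStableTFSm 𝔨 ov :=
  fun f' f fH _ hm => hc f' f fH ((override_matches_iff 𝔨 ov f' f fH).2 hm)

/-- The kit law T1d at `𝔨.override ov` implies the guarded text. [cite: Rogawski1990, §14.5 (14.5.1) p. 240] -/
theorem mTermCancellationSm_of_laws (hd : (𝔨.override ov).MTermCancellation) : MTermCancellationSm 𝔨 ov :=
  fun f' f fH _ hm => hd f' f fH ((override_matches_iff 𝔨 ov f' f fH).2 hm)

end Transport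

/-! ## §G5 The S7-currency corollary: (T-c) + (T-d) give `SJ_G + ½ SJ_H = Sθ_G + ½ Sθ_H` — PURE REARRANGEMENT [Rogawski1990, p. 240] -/

/-- **[Rogawski1990, §14.5 p. 240 (end of the proof of Thm. 14.5.1)]** For every SMOOTH `f′` and matching `(f, f^H)`, the guarded stabilised trace formulas of the quasi-split `G` and `H`
at the override ((T-c)) and the guarded cancellation of the `M`-terms ((T-d)) give `SJ_G(f) + ½ SJ_H(f^H) = Sθ_G(f) + ½ Sθ_H(f^H)` — the LEFT side in the kit's own
(un-overridden) `SJ` currency, binder shape and bytes of organ O1″ `PKtupleBaseLetterK2μ` row (T).  PURE REARRANGEMENT: no pin, no T1a, no T1b is used.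
[cite: Rogawski1990, §14.5 (14.5.1) p. 240; Thm. 10.3.1 p. 160; Prop. 11.2.1] -/
theorem sjTot_eq_sTheta_override (𝔨 : ComparisonKit L H μ) (ov : SpecOverride L)
    (hc : QuasiSplitStableTFSm 𝔨 ov) (hd : MTermCancellationSm 𝔨 ov) :
    ∀ (f' : TestGp L H) (f : TestG L) (fH : TestH L), 𝔨.Smooth f' → 𝔨.Matches f' f fH →
      𝔨.SJGtot f + (1 / 2 : ℂ) * 𝔨.SJHtot fH = ov.SθG f + (1 / 2 : ℂ) * ov.SθH fH := by
  intro f' f fH hs hm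
  obtain ⟨h3, h4⟩ := hc f' f fH hs hm
  have h5 := hd f' f fH hs hm
  linear_combination h3 + (1 / 2 : ℂ) * h4 + h5

/-- The same identity from the UNGUARDED kit laws T1c∕T1d at `𝔨.override ov` (then for every matching triple, smooth or not).
[cite: Rogawski1990, §14.5 (14.5.1) p. 240] -/
theorem sjTot_eq_sTheta_override_of_laws (𝔨 : ComparisonKit L H μ) (ov : SpecOverride L)
    (hc : (𝔨.override ov).QuasiSplitStableTraceFormulas) (hd : (𝔨.override ov).MTermCancellation)
    (f' : TestGp L H) (f : TestG L) (fH : TestH L) (hm : 𝔨.Matches f' f fH) :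
    𝔨.SJGtot f + (1 / 2 : ℂ) * 𝔨.SJHtot fH = ov.SθG f + (1 / 2 : ℂ) * ov.SθH fH := by
  obtain ⟨h3, h4⟩ := hc f' f fH ((override_matches_iff 𝔨 ov f' f fH).2 hm)
  have h5 := hd f' f fH ((override_matches_iff 𝔨 ov f' f fH).2 hm)
  change 𝔨.SJGtot f = ov.SθG f + ov.SθM f - ov.SJM f at h3
  change 𝔨.SJHtot fH = ov.SθH fH + ov.SθMH fH - ov.SJMH fH at h4
  change (ov.SθM f + (1 / 2 : ℂ) * ov.SθMH fH) - (ov.SJM f + (1 / 2 : ℂ) * ov.SJMH fH) = 0 at h5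
  linear_combination h3 + (1 / 2 : ℂ) * h4 + h5

/-! ## §G2–G4′ `IsPinned` under the override, Thm. 14.5.1 (a) transported BY NAME, and the A→B junction [Rogawski1990, pp. 237–241] -/

section Pinned

variable [∀ v : HeightOneSpectrum (𝓞 ↥(maximalRealSubfield L)), MeasurableSpace (HLocal L v)] [∀ v : HeightOneSpectrum (𝓞 ↥(maximalRealSubfield L)), BorelSpace (HLocal L v)]
  [∀ v : HeightOneSpectrum (𝓞 ↥(maximalRealSubfield L)), MeasurableSpace (GpLocal L H v)] [∀ v : HeightOneSpectrum (𝓞 ↥(maximalRealSubfield L)), BorelSpace (GpLocal L H v)]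
  [MeasurableSpace (GpInf L H)] [BorelSpace (GpInf L H)] [MeasurableSpace (GInf L)] [BorelSpace (GInf L)]
  [MeasurableSpace (HInf L)] [BorelSpace (HInf L)]

variable
    {νH : ∀ v : HeightOneSpectrum (𝓞 ↥(maximalRealSubfield L)), Measure (HLocal L v)} {νG : ∀ v : HeightOneSpectrum (𝓞 ↥(maximalRealSubfield L)), Measure (GpLocal L H v)}
    [∀ v, IsFiniteMeasureOnCompacts (νH v)] [∀ v, (νH v).IsMulRightInvariant]
    [∀ v, IsFiniteMeasureOnCompacts (νG v)] [∀ v, (νG v).IsMulRightInvariant]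
    {νGi : Measure (GpInf L H)} {νqi : Measure (GInf L)} {νHi : Measure (HInf L)}
    [IsFiniteMeasureOnCompacts νGi] [νGi.IsMulRightInvariant] [IsFiniteMeasureOnCompacts νqi] [νqi.IsMulRightInvariant]
    [IsFiniteMeasureOnCompacts νHi] [νHi.IsMulRightInvariant]
    [MeasurableSpace (GpAdelic L H)] [BorelSpace (GpAdelic L H)]
    {ν : Measure (GpAdelic L H)} [ν.IsHaarMeasure] [ν.IsInvInvariant] {Tinf : Literature.NumberTheory.Rogawski1990.ArchTransferFactor L H}

/-- **(G2) `IsPinned` IS INVARIANT UNDER THE SPECTRAL OVERRIDE** (`Iff.rfl`: the pin [T1-Kit :745–:895] constrains `traceGp, mult, μG, Smooth, ψ, Transfer, TransferH, μA, J, eSt, α,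
mGi, mqi, mHi, mH, mG, Δ, SJG, SJH, …` — none of the twelve overridden spectral sockets). [cite: Rogawski1990, §14.1–14.3 pp. 232–234; §14.6 p. 241] -/
theorem isPinned_override_iff (𝔨 : ComparisonKit L H μ) (ov : SpecOverride L) :
    (𝔨.override ov).IsPinned ν Tinf νH νG νGi νqi νHi ↔ 𝔨.IsPinned ν Tinf νH νG νGi νqi νHi :=
  Iff.rfl

/-- **(G3) [Rogawski1990, Thm. 14.5.1 (a) p. 238 + Lemma 14.5.2 pp. 238–239] T1b `EllipticStabilisation` for the OVERRIDDEN kit of a pinned kit** — ★ T1-Nonreg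
`IsPinned.ellipticStabilisation` BY NAME (hypotheses = its binder spine: the pin, anisotropy and CM-hermitian-ness of `H`, the local Haar measures with print's normalisations
`νG_v(K_v) = 1`, `νH_v(K_{H,v}) = 1` [(4.3.1), §1.7], and T1a), transported by ★ `override_ellipticStabilisation_iff` (Defs).
[cite: Rogawski1990, Thm. 14.5.1 (a) p. 238; Lemma 14.5.2 pp. 238–239] -/
theorem thm1451a_override (𝔨 : ComparisonKit L H μ) (ov : SpecOverride L) (h : 𝔨.IsPinned ν Tinf νH νG νGi νqi νHi) (hanis : IsAnisotropic L H)
    (hherm : IsHermitianCM L H)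
    (hνG : ∀ v, (νG v).IsHaarMeasure) (hK : ∀ v : HeightOneSpectrum (𝓞 ↥(maximalRealSubfield L)), νG v (UnitaryGroup.cmLocalIntegralLevel L 3 H v : Set (GpLocal L H v)) = 1)
    (hνH : ∀ v, (νH v).IsHaarMeasure)
    (hKH : ∀ v : HeightOneSpectrum (𝓞 ↥(maximalRealSubfield L)),
      νH v (((UnitaryGroup.cmLocalIntegralLevel L 2 (Matrix.of fun i j : Fin 2 => if i.val + j.val + 1 = 2 then (1 : L) else 0) v).prod
          (UnitaryGroup.cmLocalIntegralLevel L 1 (Matrix.of fun i j : Fin 1 => if i.val + j.val + 1 = 1 then (1 : L) else 0) v) :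
            Subgroup (HLocal L v)) : Set (HLocal L v)) = 1)
    (ha : 𝔨.SimpleTraceFormula) : (𝔨.override ov).EllipticStabilisation :=
  (𝔨.override_ellipticStabilisation_iff ov).2 (ComparisonKit.IsPinned.ellipticStabilisation 𝔨 h hanis hherm hνG hK hνH hKH ha)

/-- **(G4) JUNCTION A→B — [Rogawski1990, Thm. 14.5.1 (b) p. 238; proof p. 240] FOR THE OVERRIDDEN KIT OF A PINNED KIT**: `θ_{G′}(f′) = J_{G′}(f′)` (T1a, print p. 237)
`= SJ_G(f) + ½ SJ_H(f^H)` (T1b, (G3)) `= [Sθ_G(f) + ½ Sθ_H(f^H)] + [(14.5.1)]` (T1c at the override: (5.2.3)∕(10.2.3) for `G` and `H`) and `(14.5.1) = 0` (T1d at the override)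
— ★ `thm1451b_of_laws` at `𝔨.override ov`.  FED-BY (L8 (iii)): `hc` ⟸ S8-A's CM override `ov_cm` (T1c definitional, LEAD #9 (1)), `hd` ⟸ S6-B's (14.5.1) engine via the B7 bridge (ED. 2). [cite: Rogawski1990, Thm. 14.5.1 (b) p. 238; §14.5 (14.5.1) p. 240; Thm. 10.3.1 p. 160; Prop. 11.2.1] -/
theorem thm1451b_override_of_stableTF (𝔨 : ComparisonKit L H μ) (ov : SpecOverride L) (h : 𝔨.IsPinned ν Tinf νH νG νGi νqi νHi)
    (hanis : IsAnisotropic L H) (hherm : IsHermitianCM L H)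
    (hνG : ∀ v, (νG v).IsHaarMeasure) (hK : ∀ v : HeightOneSpectrum (𝓞 ↥(maximalRealSubfield L)), νG v (UnitaryGroup.cmLocalIntegralLevel L 3 H v : Set (GpLocal L H v)) = 1)
    (hνH : ∀ v, (νH v).IsHaarMeasure)
    (hKH : ∀ v : HeightOneSpectrum (𝓞 ↥(maximalRealSubfield L)),
      νH v (((UnitaryGroup.cmLocalIntegralLevel L 2 (Matrix.of fun i j : Fin 2 => if i.val + j.val + 1 = 2 then (1 : L) else 0) v).prod
          (UnitaryGroup.cmLocalIntegralLevel L 1 (Matrix.of fun i j : Fin 1 => if i.val + j.val + 1 = 1 then (1 : L) else 0) v) :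
            Subgroup (HLocal L v)) : Set (HLocal L v)) = 1)
    (ha : 𝔨.SimpleTraceFormula) (hc : (𝔨.override ov).QuasiSplitStableTraceFormulas) (hd : (𝔨.override ov).MTermCancellation) :
    (𝔨.override ov).Thm1451b :=
  (𝔨.override ov).thm1451b_of_laws ((𝔨.override_simpleTraceFormula_iff ov).2 ha) (thm1451a_override 𝔨 ov h hanis hherm hνG hK hνH hKH ha) hc hd

/-- **(G4′) the same, read in the kit's trace currency and the override's `Sθ` heads**: `θ_{G′}(f′) = Sθ_G(f) + ½ Sθ_H(f^H)` for every matching triple.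
[cite: Rogawski1990, Thm. 14.5.1 (b) p. 238] -/
theorem traceGp_eq_sTheta_override_of_stableTF (𝔨 : ComparisonKit L H μ) (ov : SpecOverride L) (h : 𝔨.IsPinned ν Tinf νH νG νGi νqi νHi)
    (hanis : IsAnisotropic L H) (hherm : IsHermitianCM L H)
    (hνG : ∀ v, (νG v).IsHaarMeasure) (hK : ∀ v : HeightOneSpectrum (𝓞 ↥(maximalRealSubfield L)), νG v (UnitaryGroup.cmLocalIntegralLevel L 3 H v : Set (GpLocal L H v)) = 1)
    (hνH : ∀ v, (νH v).IsHaarMeasure)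
    (hKH : ∀ v : HeightOneSpectrum (𝓞 ↥(maximalRealSubfield L)),
      νH v (((UnitaryGroup.cmLocalIntegralLevel L 2 (Matrix.of fun i j : Fin 2 => if i.val + j.val + 1 = 2 then (1 : L) else 0) v).prod
          (UnitaryGroup.cmLocalIntegralLevel L 1 (Matrix.of fun i j : Fin 1 => if i.val + j.val + 1 = 1 then (1 : L) else 0) v) :
            Subgroup (HLocal L v)) : Set (HLocal L v)) = 1)
    (ha : 𝔨.SimpleTraceFormula) (hc : (𝔨.override ov).QuasiSplitStableTraceFormulas) (hd : (𝔨.override ov).MTermCancellation)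
    (f' : TestGp L H) (f : TestG L) (fH : TestH L) (hm : 𝔨.Matches f' f fH) :
    𝔨.traceGp f' = ov.SθG f + (1 / 2 : ℂ) * ov.SθH fH :=
  (override_thm1451b_iff 𝔨 ov).1 (thm1451b_override_of_stableTF 𝔨 ov h hanis hherm hνG hK hνH hKH ha hc hd) f' f fH hm

/-- **(G4′) DEAL v1.1 — [Rogawski1990, Thm. 14.5.1 (b) p. 238; proof p. 240] FROM THE SMOOTH-GUARDED TEXTS**: for a pinned kit with T1a, (T-c) and (T-d) at `ov` give, for
every SMOOTH `f′` and matching `(f, f^H)`, `θ_{G′}(f′) = Sθ_G(f) + ½ Sθ_H(f^H)` — `θ_{G′}(f′) = J_{G′}(f′)` (T1a, p. 237) `= SJ_G(f) + ½ SJ_H(f^H)` (T1b ★ `IsPinned.ellipticStabilisation`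
at `𝔨`, Thm. 14.5.1 (a)) `= Sθ_G(f) + ½ Sθ_H(f^H)` ((G5)): the ten-line algebra of ★ `thm1451b_of_laws` re-run on the guarded texts.  FED-BY (L8 (iii)): `hc` ⟸ S8-A's
`ov_cm`, `hd` ⟸ S6-B's (14.5.1) engine via the B7 bridge (ED. 2).
[cite: Rogawski1990, Thm. 14.5.1 (b) p. 238; §14.5 (14.5.1) p. 240; Thm. 10.3.1 p. 160; Prop. 11.2.1] -/
theorem thm1451bSm_override (𝔨 : ComparisonKit L H μ) (ov : SpecOverride L) (h : 𝔨.IsPinned ν Tinf νH νG νGi νqi νHi)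
    (hanis : IsAnisotropic L H) (hherm : IsHermitianCM L H)
    (hνG : ∀ v, (νG v).IsHaarMeasure) (hK : ∀ v : HeightOneSpectrum (𝓞 ↥(maximalRealSubfield L)), νG v (UnitaryGroup.cmLocalIntegralLevel L 3 H v : Set (GpLocal L H v)) = 1)
    (hνH : ∀ v, (νH v).IsHaarMeasure)
    (hKH : ∀ v : HeightOneSpectrum (𝓞 ↥(maximalRealSubfield L)),
      νH v (((UnitaryGroup.cmLocalIntegralLevel L 2 (Matrix.of fun i j : Fin 2 => if i.val + j.val + 1 = 2 then (1 : L) else 0) v).prod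
          (UnitaryGroup.cmLocalIntegralLevel L 1 (Matrix.of fun i j : Fin 1 => if i.val + j.val + 1 = 1 then (1 : L) else 0) v) :
            Subgroup (HLocal L v)) : Set (HLocal L v)) = 1)
    (ha : 𝔨.SimpleTraceFormula) (hc : QuasiSplitStableTFSm 𝔨 ov) (hd : MTermCancellationSm 𝔨 ov) :
    ∀ (f' : TestGp L H) (f : TestG L) (fH : TestH L), 𝔨.Smooth f' → 𝔨.Matches f' f fH →
      𝔨.traceGp f' = ov.SθG f + (1 / 2 : ℂ) * ov.SθH fH := by
  intro f' f fH hs hm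
  have h1 : 𝔨.traceGp f' = 𝔨.JGp f' := (ha f').2
  have h2 : 𝔨.JGp f' = 𝔨.SJGtot f + (1 / 2 : ℂ) * 𝔨.SJHtot fH :=
    (ComparisonKit.IsPinned.ellipticStabilisation 𝔨 h hanis hherm hνG hK hνH hKH ha f' f fH hm).2
  rw [h1, h2]
  exact sjTot_eq_sTheta_override 𝔨 ov hc hd f' f fH hs hm

end Pinned

/-! ## §B7 (ED. 2) THE BRIDGE FROM FILE B's (14.5.1) ENGINE — `MTermCancellationSm 𝔨 ov` from the Hecke dichotomy [Rogawski1990, §14.5 (14.5.1) p. 240] -/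

section Bridge

variable {L : Type} [Field L] [NumberField L] [IsCMField L] {H : Matrix (Fin 3) (Fin 3) L}
  {μ : Measure (UnitaryGroup.cmDatum L 3 H).automorphicQuotient} [(UnitaryGroup.cmDatum L 3 H).IsAutomorphicMeasure μ]

/-- **(B7) [Rogawski1990, §14.5 (14.5.1) p. 240; §10.3 p. 159 (Langlands' decomposition of measures)] — T1d AT THE OVERRIDE FROM FILE B's ENGINE (pin-free form, T1b a
hypothesis):** the guarded T1c text `QuasiSplitStableTFSm 𝔨 ov`, FILE B's Hecke dichotomy `HeckeDichotomyOv 𝔨 ov` and Langlands' lemma `LanglandsDichotomy` give the guarded T1d text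
`MTermCancellationSm 𝔨 ov` — FILE B's head `mTermCancellationSm_of_dichotomy_of_T1b` BY NAME (its hypothesis∕conclusion are the bodies of (T-c)∕(T-d) byte-for-byte; `exact` by `rfl`-unfolding).
[cite: Rogawski1990, §14.5 (14.5.1) p. 240; §10.3 p. 159] -/
theorem mTermCancellationSm_of_spectralB (𝔨 : ComparisonKit L H μ) (ov : SpecOverride L) (ha : 𝔨.SimpleTraceFormula) (hb : 𝔨.EllipticStabilisation)
    (hc : QuasiSplitStableTFSm 𝔨 ov) (hV : HeckeDichotomyOv 𝔨 ov) (hL : LanglandsDichotomy) : MTermCancellationSm 𝔨 ov :=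
  mTermCancellationSm_of_dichotomy_of_T1b 𝔨 ha hb ov hc hV hL

/-- **(B7∘G5) [Rogawski1990, §14.5 p. 240] the S7-currency identity from FILE B's engine (pin-free):** `SJ_G(f) + ½ SJ_H(f^H) = Sθ_G(f) + ½ Sθ_H(f^H)` for every SMOOTH `f′` and
matching `(f, f^H)`, from T1a, T1b, (T-c) at `ov`, the Hecke dichotomy at `ov` and Langlands' lemma.  [cite: Rogawski1990, §14.5 (14.5.1) p. 240; Thm. 10.3.1 p. 160] -/
theorem sjTot_eq_sTheta_of_dichotomy (𝔨 : ComparisonKit L H μ) (ov : SpecOverride L) (ha : 𝔨.SimpleTraceFormula) (hb : 𝔨.EllipticStabilisation)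
    (hc : QuasiSplitStableTFSm 𝔨 ov) (hV : HeckeDichotomyOv 𝔨 ov) (hL : LanglandsDichotomy) :
    ∀ (f' : TestGp L H) (f : TestG L) (fH : TestH L), 𝔨.Smooth f' → 𝔨.Matches f' f fH →
      𝔨.SJGtot f + (1 / 2 : ℂ) * 𝔨.SJHtot fH = ov.SθG f + (1 / 2 : ℂ) * ov.SθH fH :=
  sjTot_eq_sTheta_override 𝔨 ov hc (mTermCancellationSm_of_spectralB 𝔨 ov ha hb hc hV hL)

end Bridge

section PinnedBridge

variable {L : Type} [Field L] [NumberField L] [IsCMField L] {H : Matrix (Fin 3) (Fin 3) L}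
  {μ : Measure (UnitaryGroup.cmDatum L 3 H).automorphicQuotient} [(UnitaryGroup.cmDatum L 3 H).IsAutomorphicMeasure μ]

variable [∀ v : HeightOneSpectrum (𝓞 ↥(maximalRealSubfield L)), MeasurableSpace (HLocal L v)] [∀ v : HeightOneSpectrum (𝓞 ↥(maximalRealSubfield L)), BorelSpace (HLocal L v)]
  [∀ v : HeightOneSpectrum (𝓞 ↥(maximalRealSubfield L)), MeasurableSpace (GpLocal L H v)] [∀ v : HeightOneSpectrum (𝓞 ↥(maximalRealSubfield L)), BorelSpace (GpLocal L H v)]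
  [MeasurableSpace (GpInf L H)] [BorelSpace (GpInf L H)] [MeasurableSpace (GInf L)] [BorelSpace (GInf L)] [MeasurableSpace (HInf L)] [BorelSpace (HInf L)]
  {νH : (v : HeightOneSpectrum (𝓞 ↥(maximalRealSubfield L))) → Measure (HLocal L v)}
  {νG : (v : HeightOneSpectrum (𝓞 ↥(maximalRealSubfield L))) → Measure (GpLocal L H v)}
  [∀ v, IsFiniteMeasureOnCompacts (νH v)] [∀ v, (νH v).IsMulRightInvariant] [∀ v, IsFiniteMeasureOnCompacts (νG v)] [∀ v, (νG v).IsMulRightInvariant]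
  {νGi : Measure (GpInf L H)} {νqi : Measure (GInf L)} {νHi : Measure (HInf L)}
  [IsFiniteMeasureOnCompacts νGi] [νGi.IsMulRightInvariant] [IsFiniteMeasureOnCompacts νqi] [νqi.IsMulRightInvariant] [IsFiniteMeasureOnCompacts νHi] [νHi.IsMulRightInvariant]
  [MeasurableSpace (GpAdelic L H)] [BorelSpace (GpAdelic L H)] {ν : Measure (GpAdelic L H)} [ν.IsHaarMeasure] [ν.IsInvInvariant]
  {Tinf : Literature.NumberTheory.Rogawski1990.ArchTransferFactor L H}

/-- **(B7-pinned) [Rogawski1990, §14.5 (14.5.1) p. 240; Thm. 14.5.1 (a) p. 238]** T1d at the override from FILE B's engine FOR EVERY PINNED KIT — FILE B's head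
`mTermCancellationSm_of_dichotomy` BY NAME («P» prefix = Nonreg (F-4) verbatim).  [cite: Rogawski1990, §14.5 (14.5.1) p. 240; Thm. 14.5.1 (a) p. 238] -/
theorem mTermCancellationSm_of_spectralB_pinned (𝔨 : ComparisonKit L H μ) (ov : SpecOverride L) (h : 𝔨.IsPinned ν Tinf νH νG νGi νqi νHi)
    (hanis : IsAnisotropic L H) (hherm : IsHermitianCM L H)
    (hνG : ∀ v, (νG v).IsHaarMeasure) (hK : ∀ v : HeightOneSpectrum (𝓞 ↥(maximalRealSubfield L)), νG v (UnitaryGroup.cmLocalIntegralLevel L 3 H v : Set (GpLocal L H v)) = 1)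
    (hνH : ∀ v, (νH v).IsHaarMeasure)
    (hKH : ∀ v : HeightOneSpectrum (𝓞 ↥(maximalRealSubfield L)),
      νH v (((UnitaryGroup.cmLocalIntegralLevel L 2 (Matrix.of fun i j : Fin 2 => if i.val + j.val + 1 = 2 then (1 : L) else 0) v).prod
          (UnitaryGroup.cmLocalIntegralLevel L 1 (Matrix.of fun i j : Fin 1 => if i.val + j.val + 1 = 1 then (1 : L) else 0) v) :
            Subgroup (HLocal L v)) : Set (HLocal L v)) = 1)
    (ha : 𝔨.SimpleTraceFormula) (hc : QuasiSplitStableTFSm 𝔨 ov) (hV : HeckeDichotomyOv 𝔨 ov) (hL : LanglandsDichotomy) : MTermCancellationSm 𝔨 ov :=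
  mTermCancellationSm_of_dichotomy 𝔨 h hanis hherm hνG hK hνH hKH ha ov hc hV hL

/-- **(G4′∘B7) THE S6 TOP AT A GENERIC OVERRIDE [Rogawski1990, Thm. 14.5.1 (b) p. 238; proof pp. 239–240]:** for every pinned kit with T1a, the guarded T1c text at `ov`,
FILE B's Hecke dichotomy at `ov` and Langlands' lemma give, for every SMOOTH `f′` and matching `(f, f^H)`, `θ_{G′}(f′) = Sθ_G(f) + ½ Sθ_H(f^H)` — (G4′) fed by (B7-pinned).
ED. 3 instantiates `ov := ov_cm` (S8) and `hV := sock_S6_heckeDichotomy_cm` (FILE C).  [cite: Rogawski1990, Thm. 14.5.1 (b) p. 238; §14.5 (14.5.1) p. 240] -/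
theorem thm1451bSm_of_dichotomy (𝔨 : ComparisonKit L H μ) (ov : SpecOverride L) (h : 𝔨.IsPinned ν Tinf νH νG νGi νqi νHi)
    (hanis : IsAnisotropic L H) (hherm : IsHermitianCM L H)
    (hνG : ∀ v, (νG v).IsHaarMeasure) (hK : ∀ v : HeightOneSpectrum (𝓞 ↥(maximalRealSubfield L)), νG v (UnitaryGroup.cmLocalIntegralLevel L 3 H v : Set (GpLocal L H v)) = 1)
    (hνH : ∀ v, (νH v).IsHaarMeasure)
    (hKH : ∀ v : HeightOneSpectrum (𝓞 ↥(maximalRealSubfield L)),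
      νH v (((UnitaryGroup.cmLocalIntegralLevel L 2 (Matrix.of fun i j : Fin 2 => if i.val + j.val + 1 = 2 then (1 : L) else 0) v).prod
          (UnitaryGroup.cmLocalIntegralLevel L 1 (Matrix.of fun i j : Fin 1 => if i.val + j.val + 1 = 1 then (1 : L) else 0) v) :
            Subgroup (HLocal L v)) : Set (HLocal L v)) = 1)
    (ha : 𝔨.SimpleTraceFormula) (hc : QuasiSplitStableTFSm 𝔨 ov) (hV : HeckeDichotomyOv 𝔨 ov) (hL : LanglandsDichotomy) :
    ∀ (f' : TestGp L H) (f : TestG L) (fH : TestH L), 𝔨.Smooth f' → 𝔨.Matches f' f fH →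
      𝔨.traceGp f' = ov.SθG f + (1 / 2 : ℂ) * ov.SθH fH :=
  thm1451bSm_override 𝔨 ov h hanis hherm hνG hK hνH hKH ha hc (mTermCancellationSm_of_spectralB_pinned 𝔨 ov h hanis hherm hνG hK hνH hKH ha hc hV hL)

/-- (G4′∘B7 with FILE B's socket `sock_S6_langlandsDichotomy` plugged — `sorry`-tainted THROUGH THAT SOCKET ONLY; the remaining named inputs are the guarded T1c text at `ov`
and the Hecke dichotomy at `ov`.)  [cite: Rogawski1990, Thm. 14.5.1 (b) p. 238; §14.5 (14.5.1) p. 240] -/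
theorem thm1451bSm_of_dichotomy_S6 (𝔨 : ComparisonKit L H μ) (ov : SpecOverride L) (h : 𝔨.IsPinned ν Tinf νH νG νGi νqi νHi)
    (hanis : IsAnisotropic L H) (hherm : IsHermitianCM L H)
    (hνG : ∀ v, (νG v).IsHaarMeasure) (hK : ∀ v : HeightOneSpectrum (𝓞 ↥(maximalRealSubfield L)), νG v (UnitaryGroup.cmLocalIntegralLevel L 3 H v : Set (GpLocal L H v)) = 1)
    (hνH : ∀ v, (νH v).IsHaarMeasure)
    (hKH : ∀ v : HeightOneSpectrum (𝓞 ↥(maximalRealSubfield L)),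
      νH v (((UnitaryGroup.cmLocalIntegralLevel L 2 (Matrix.of fun i j : Fin 2 => if i.val + j.val + 1 = 2 then (1 : L) else 0) v).prod
          (UnitaryGroup.cmLocalIntegralLevel L 1 (Matrix.of fun i j : Fin 1 => if i.val + j.val + 1 = 1 then (1 : L) else 0) v) :
            Subgroup (HLocal L v)) : Set (HLocal L v)) = 1)
    (ha : 𝔨.SimpleTraceFormula) (hc : QuasiSplitStableTFSm 𝔨 ov) (hV : HeckeDichotomyOv 𝔨 ov) :
    ∀ (f' : TestGp L H) (f : TestG L) (fH : TestH L), 𝔨.Smooth f' → 𝔨.Matches f' f fH →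
      𝔨.traceGp f' = ov.SθG f + (1 / 2 : ℂ) * ov.SθH fH :=
  thm1451bSm_of_dichotomy 𝔨 ov h hanis hherm hνG hK hνH hKH ha hc hV sock_S6_langlandsDichotomy

end PinnedBridge

/-! ## §AS (ED. 3) THE ARTHUR-SIMPLE OVERRIDE — Q-S1 of record: transfers cuspidal at ≥ 2 places ⇒ NO `M`-terms; body = R90-C14-plan's SHEET
`S6_A_ed3_arthurSimple.v1.R90-C14-plan-g0.lean` b7edd0e2f4f4076e ll. 26–176 VERBATIM [Rogawski1990, §14.5 p. 240; (14.5.1) pp. 240–241; Thm. 14.6.1 p. 241] -/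

section ArthurSimple

variable (𝔨 : ComparisonKit L H μ) (PacketG PacketH : Type) (nG : PacketG → ℂ) (nH : PacketH → ℂ)
  (trG : PacketG → TestG L → ℂ) (trH : PacketH → TestH L → ℂ)

/-- **(AS0) [Rogawski1990, §14.5 p. 240; Thm. 14.6.1 p. 241] the ARTHUR-SIMPLE OVERRIDE of `𝔨` with packet data `(PacketG, PacketH, nG, nH, trG, trH)`**:
`Sθ_G := SJ_G`, `Sθ_H := SJ_H`, `Sθ_M = SJ_M = Sθ_{M_H} = SJ_{M_H} := 0` (two-place edition: the `M`-terms vanish on transfers). DATA ONLY.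
[cite: Rogawski1990, §14.5 (14.5.1) p. 240; Thm. 14.6.1 p. 241] -/
noncomputable def arthurSimpleOverride : SpecOverride L :=
  { SθG := 𝔨.SJGtot, SθH := 𝔨.SJHtot, SθM := 0, SJM := 0, SθMH := 0, SJMH := 0
    PacketG := PacketG, PacketH := PacketH, nG := nG, nH := nH, trG := trG, trH := trH }

@[simp] theorem arthurSimpleOverride_SθG : (arthurSimpleOverride 𝔨 PacketG PacketH nG nH trG trH).SθG = 𝔨.SJGtot := rfl
@[simp] theorem arthurSimpleOverride_SθH : (arthurSimpleOverride 𝔨 PacketG PacketH nG nH trG trH).SθH = 𝔨.SJHtot := rfl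
@[simp] theorem arthurSimpleOverride_SθM : (arthurSimpleOverride 𝔨 PacketG PacketH nG nH trG trH).SθM = 0 := rfl
@[simp] theorem arthurSimpleOverride_SJM : (arthurSimpleOverride 𝔨 PacketG PacketH nG nH trG trH).SJM = 0 := rfl
@[simp] theorem arthurSimpleOverride_SθMH : (arthurSimpleOverride 𝔨 PacketG PacketH nG nH trG trH).SθMH = 0 := rfl
@[simp] theorem arthurSimpleOverride_SJMH : (arthurSimpleOverride 𝔨 PacketG PacketH nG nH trG trH).SJMH = 0 := rfl
@[simp] theorem arthurSimpleOverride_nG : (arthurSimpleOverride 𝔨 PacketG PacketH nG nH trG trH).nG = nG := rfl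
@[simp] theorem arthurSimpleOverride_nH : (arthurSimpleOverride 𝔨 PacketG PacketH nG nH trG trH).nH = nH := rfl
@[simp] theorem arthurSimpleOverride_trG : (arthurSimpleOverride 𝔨 PacketG PacketH nG nH trG trH).trG = trG := rfl
@[simp] theorem arthurSimpleOverride_trH : (arthurSimpleOverride 𝔨 PacketG PacketH nG nH trG trH).trH = trH := rfl

/-- **(AS1) T1c AT THE ARTHUR-SIMPLE OVERRIDE is an identity of the edition**: `SJ_G(f) = SJ_G(f) + 0 − 0`, `SJ_H(f^H) = SJ_H(f^H) + 0 − 0`.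
[cite: Rogawski1990, §14.5 p. 240; Thm. 10.3.1 p. 160; Prop. 11.2.1] -/
theorem quasiSplitStableTraceFormulas_arthurSimple :
    (𝔨.override (arthurSimpleOverride 𝔨 PacketG PacketH nG nH trG trH)).QuasiSplitStableTraceFormulas := by
  intro f' f fH _
  change 𝔨.SJGtot f = 𝔨.SJGtot f + (0 : TestG L → ℂ) f - (0 : TestG L → ℂ) f ∧
    𝔨.SJHtot fH = 𝔨.SJHtot fH + (0 : TestH L → ℂ) fH - (0 : TestH L → ℂ) fH
  simp

/-- **(AS2) T1d AT THE ARTHUR-SIMPLE OVERRIDE is `0 − 0 = 0`** — (14.5.1) in the two-place edition. [cite: Rogawski1990, §14.5 (14.5.1) p. 240] -/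
theorem mTermCancellation_arthurSimple :
    (𝔨.override (arthurSimpleOverride 𝔨 PacketG PacketH nG nH trG trH)).MTermCancellation := by
  intro f' f fH _
  change ((0 : TestG L → ℂ) f + (1 / 2 : ℂ) * (0 : TestH L → ℂ) fH) - ((0 : TestG L → ℂ) f + (1 / 2 : ℂ) * (0 : TestH L → ℂ) fH) = 0
  simp

/-- **(AS3) [Rogawski1990, Thm. 14.5.1 (b) p. 238] AT THE ARTHUR-SIMPLE OVERRIDE FROM T1a + T1b ALONE (kit-generic, pin-free form)**:
`θ_{G′}(f′) = J_{G′}(f′) = SJ_G(f) + ½ SJ_H(f^H) = Sθ_G(f) + ½ Sθ_H(f^H)`. [cite: Rogawski1990, Thm. 14.5.1 (b) p. 238; §14.5 p. 240] -/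
theorem thm1451b_arthurSimple (ha : 𝔨.SimpleTraceFormula) (hb : 𝔨.EllipticStabilisation) :
    (𝔨.override (arthurSimpleOverride 𝔨 PacketG PacketH nG nH trG trH)).Thm1451b :=
  (𝔨.override _).thm1451b_of_laws ((𝔨.override_simpleTraceFormula_iff _).2 ha) ((𝔨.override_ellipticStabilisation_iff _).2 hb)
    (quasiSplitStableTraceFormulas_arthurSimple 𝔨 PacketG PacketH nG nH trG trH) (mTermCancellation_arthurSimple 𝔨 PacketG PacketH nG nH trG trH)

/-- **(AS4) T1e READ AT THE ARTHUR-SIMPLE OVERRIDE** = the ON-PATH spectral socket for `G`: on transfers `f` of smooth `G′`-functions, `Σ_Π n(Π) Tr Π(f)` is summable and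
equals the stable elliptic total `SJ_G(f)` (Arthur's simple trace formula for `U(Φ₃)` tested against functions cuspidal at two archimedean places, stabilised and regrouped
in packets). [cite: Rogawski1990, Thm. 14.6.1 proof p. 241; Prop. 13.6.2; Thm. 13.3.7] [cite: Arthur1988InvariantTraceFormulaII, §7 Cor. 7.2–7.4 pp. 539–540] -/
theorem stableSpectralExpansionG_arthurSimple_iff :
    (𝔨.override (arthurSimpleOverride 𝔨 PacketG PacketH nG nH trG trH)).StableSpectralExpansionG ↔
      ∀ (f' : TestGp L H) (f : TestG L), 𝔨.Smooth f' → 𝔨.Transfer f' f →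
        Summable (fun P : PacketG => nG P * trG P f) ∧ 𝔨.SJGtot f = ∑' P : PacketG, nG P * trG P f :=
  Iff.rfl

/-- **(AS5) T1f READ AT THE ARTHUR-SIMPLE OVERRIDE** = the ON-PATH spectral socket for `H`. [cite: Rogawski1990, Thm. 14.6.1 proof p. 241; Prop. 13.6.1; Prop. 11.2.1] -/
theorem stableSpectralExpansionH_arthurSimple_iff :
    (𝔨.override (arthurSimpleOverride 𝔨 PacketG PacketH nG nH trG trH)).StableSpectralExpansionH ↔
      ∀ (f' : TestGp L H) (fH : TestH L), 𝔨.Smooth f' → 𝔨.TransferH f' fH →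
        Summable (fun r : PacketH => nH r * trH r fH) ∧ 𝔨.SJHtot fH = ∑' r : PacketH, nH r * trH r fH :=
  Iff.rfl

/-- **(AS6) `SpecPkgT1` AT THE ARTHUR-SIMPLE OVERRIDE from the two on-path spectral sockets alone** (T1c, T1d are (AS1), (AS2)). [cite: Rogawski1990, Thm. 14.6.1 p. 241] -/
theorem specPkgT1_arthurSimple (he : (𝔨.override (arthurSimpleOverride 𝔨 PacketG PacketH nG nH trG trH)).StableSpectralExpansionG)
    (hf : (𝔨.override (arthurSimpleOverride 𝔨 PacketG PacketH nG nH trG trH)).StableSpectralExpansionH) :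
    (𝔨.override (arthurSimpleOverride 𝔨 PacketG PacketH nG nH trG trH)).SpecPkgT1 :=
  ⟨quasiSplitStableTraceFormulas_arthurSimple 𝔨 PacketG PacketH nG nH trG trH, mTermCancellation_arthurSimple 𝔨 PacketG PacketH nG nH trG trH, he, hf⟩

/-- **(AS7) `LawsT1` AT THE ARTHUR-SIMPLE OVERRIDE** from T1a, T1b, T1g at `𝔨` and the two on-path spectral sockets. [cite: Rogawski1990, §§14.2–14.6] -/
theorem lawsT1_arthurSimple (ha : 𝔨.SimpleTraceFormula) (hb : 𝔨.EllipticStabilisation) (hg : 𝔨.TransferExistence)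
    (he : (𝔨.override (arthurSimpleOverride 𝔨 PacketG PacketH nG nH trG trH)).StableSpectralExpansionG)
    (hf : (𝔨.override (arthurSimpleOverride 𝔨 PacketG PacketH nG nH trG trH)).StableSpectralExpansionH) :
    (𝔨.override (arthurSimpleOverride 𝔨 PacketG PacketH nG nH trG trH)).LawsT1 :=
  ⟨(𝔨.override_simpleTraceFormula_iff _).2 ha, (𝔨.override_ellipticStabilisation_iff _).2 hb,
    quasiSplitStableTraceFormulas_arthurSimple 𝔨 PacketG PacketH nG nH trG trH, mTermCancellation_arthurSimple 𝔨 PacketG PacketH nG nH trG trH, he, hf,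
    (𝔨.override_transferExistence_iff _).2 hg⟩

/-- **(AS8) [Rogawski1990, Thm. 14.6.1 p. 241, (14.6.1)] AT THE ARTHUR-SIMPLE OVERRIDE**: `Tr ρ_d(f′) = Σ_Π n(Π) Tr Π(f) + ½ Σ_ρ n(ρ) Tr ρ(f′^H)` for smooth `f′` and
matching `(f, f′^H)`, from T1a, T1b, T1g and the two on-path spectral sockets — ★ `innerFormStableTraceIdentity_of_laws` at the override.
[cite: Rogawski1990, Thm. 14.6.1 p. 241] -/
theorem innerFormStableTraceIdentity_arthurSimple (ha : 𝔨.SimpleTraceFormula) (hb : 𝔨.EllipticStabilisation) (hg : 𝔨.TransferExistence)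
    (he : (𝔨.override (arthurSimpleOverride 𝔨 PacketG PacketH nG nH trG trH)).StableSpectralExpansionG)
    (hf : (𝔨.override (arthurSimpleOverride 𝔨 PacketG PacketH nG nH trG trH)).StableSpectralExpansionH) :
    (𝔨.override (arthurSimpleOverride 𝔨 PacketG PacketH nG nH trG trH)).InnerFormStableTraceIdentity :=
  (𝔨.override _).innerFormStableTraceIdentity_of_laws (lawsT1_arthurSimple 𝔨 PacketG PacketH nG nH trG trH ha hb hg he hf)

/-- **(AS8′) (14.6.1) at the Arthur-simple override, UNFOLDED to the kit's trace and the packet sums.** [cite: Rogawski1990, Thm. 14.6.1 p. 241] -/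
theorem traceGp_eq_spec_arthurSimple (ha : 𝔨.SimpleTraceFormula) (hb : 𝔨.EllipticStabilisation) (hg : 𝔨.TransferExistence)
    (he : (𝔨.override (arthurSimpleOverride 𝔨 PacketG PacketH nG nH trG trH)).StableSpectralExpansionG)
    (hf : (𝔨.override (arthurSimpleOverride 𝔨 PacketG PacketH nG nH trG trH)).StableSpectralExpansionH)
    (f' : TestGp L H) (f : TestG L) (fH : TestH L) (hs : 𝔨.Smooth f') (hm : 𝔨.Matches f' f fH) :
    Summable (fun P : PacketG => nG P * trG P f) ∧ Summable (fun r : PacketH => nH r * trH r fH) ∧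
      𝔨.traceGp f' = (∑' P : PacketG, nG P * trG P f) + (1 / 2 : ℂ) * ∑' r : PacketH, nH r * trH r fH :=
  innerFormStableTraceIdentity_arthurSimple 𝔨 PacketG PacketH nG nH trG trH ha hb hg he hf f' f fH hs hm

end ArthurSimple

/-! ### (AS3-pinned) Thm. 14.5.1 (b) at the Arthur-simple override of a PINNED kit — T1b discharged by ★ `IsPinned.ellipticStabilisation` via (G3) -/

section ArthurSimplePinned

variable [∀ v : HeightOneSpectrum (𝓞 ↥(maximalRealSubfield L)), MeasurableSpace (HLocal L v)] [∀ v : HeightOneSpectrum (𝓞 ↥(maximalRealSubfield L)), BorelSpace (HLocal L v)]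
  [∀ v : HeightOneSpectrum (𝓞 ↥(maximalRealSubfield L)), MeasurableSpace (GpLocal L H v)] [∀ v : HeightOneSpectrum (𝓞 ↥(maximalRealSubfield L)), BorelSpace (GpLocal L H v)]
  [MeasurableSpace (GpInf L H)] [BorelSpace (GpInf L H)] [MeasurableSpace (GInf L)] [BorelSpace (GInf L)]
  [MeasurableSpace (HInf L)] [BorelSpace (HInf L)]

variable
    {νH : ∀ v : HeightOneSpectrum (𝓞 ↥(maximalRealSubfield L)), Measure (HLocal L v)} {νG : ∀ v : HeightOneSpectrum (𝓞 ↥(maximalRealSubfield L)), Measure (GpLocal L H v)}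
    [∀ v, IsFiniteMeasureOnCompacts (νH v)] [∀ v, (νH v).IsMulRightInvariant]
    [∀ v, IsFiniteMeasureOnCompacts (νG v)] [∀ v, (νG v).IsMulRightInvariant]
    {νGi : Measure (GpInf L H)} {νqi : Measure (GInf L)} {νHi : Measure (HInf L)}
    [IsFiniteMeasureOnCompacts νGi] [νGi.IsMulRightInvariant] [IsFiniteMeasureOnCompacts νqi] [νqi.IsMulRightInvariant]
    [IsFiniteMeasureOnCompacts νHi] [νHi.IsMulRightInvariant]
    [MeasurableSpace (GpAdelic L H)] [BorelSpace (GpAdelic L H)]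
    {ν : Measure (GpAdelic L H)} [ν.IsHaarMeasure] [ν.IsInvInvariant] {Tinf : Literature.NumberTheory.Rogawski1990.ArchTransferFactor L H}

/-- **(AS3-pinned) [Rogawski1990, Thm. 14.5.1 (b) p. 238] at the Arthur-simple override of a PINNED kit with T1a** — (G4) with `hc`, `hd` := (AS1), (AS2).
[cite: Rogawski1990, Thm. 14.5.1 (b) p. 238; §14.5 p. 240] -/
theorem thm1451b_arthurSimple_pinned (𝔨 : ComparisonKit L H μ) (PacketG PacketH : Type) (nG : PacketG → ℂ) (nH : PacketH → ℂ)
    (trG : PacketG → TestG L → ℂ) (trH : PacketH → TestH L → ℂ) (h : 𝔨.IsPinned ν Tinf νH νG νGi νqi νHi)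
    (hanis : IsAnisotropic L H) (hherm : IsHermitianCM L H)
    (hνG : ∀ v, (νG v).IsHaarMeasure) (hK : ∀ v : HeightOneSpectrum (𝓞 ↥(maximalRealSubfield L)), νG v (UnitaryGroup.cmLocalIntegralLevel L 3 H v : Set (GpLocal L H v)) = 1)
    (hνH : ∀ v, (νH v).IsHaarMeasure)
    (hKH : ∀ v : HeightOneSpectrum (𝓞 ↥(maximalRealSubfield L)),
      νH v (((UnitaryGroup.cmLocalIntegralLevel L 2 (Matrix.of fun i j : Fin 2 => if i.val + j.val + 1 = 2 then (1 : L) else 0) v).prod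
          (UnitaryGroup.cmLocalIntegralLevel L 1 (Matrix.of fun i j : Fin 1 => if i.val + j.val + 1 = 1 then (1 : L) else 0) v) :
            Subgroup (HLocal L v)) : Set (HLocal L v)) = 1)
    (ha : 𝔨.SimpleTraceFormula) :
    (𝔨.override (arthurSimpleOverride 𝔨 PacketG PacketH nG nH trG trH)).Thm1451b :=
  thm1451b_override_of_stableTF 𝔨 _ h hanis hherm hνG hK hνH hKH ha
    (quasiSplitStableTraceFormulas_arthurSimple 𝔨 PacketG PacketH nG nH trG trH) (mTermCancellation_arthurSimple 𝔨 PacketG PacketH nG nH trG trH)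

/-- **(AS9) THE S9∕S7 CURRENCY HEAD ON PATH — [Rogawski1990, Thm. 14.5.1 (a)(b) p. 238] for a PINNED kit with T1a, in the Smooth-guarded binder shape of
`sock_S9_thm1451b_cm` ∕ organ O1″ row (T) with the Arthur-simple pair `SθG := 𝔨.SJGtot`, `SθH := 𝔨.SJHtot`**: `θ_{G′}(f′) = SJ_G(f) + ½ SJ_H(f^H)` — T1a then ★
`IsPinned.ellipticStabilisation`; no T1c∕T1d∕T1e∕T1f, no `ov`. [cite: Rogawski1990, Thm. 14.5.1 (a)(b) p. 238; §14.5 pp. 237–240] -/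
theorem traceGp_eq_sjTot_pinned (𝔨 : ComparisonKit L H μ) (h : 𝔨.IsPinned ν Tinf νH νG νGi νqi νHi)
    (hanis : IsAnisotropic L H) (hherm : IsHermitianCM L H)
    (hνG : ∀ v, (νG v).IsHaarMeasure) (hK : ∀ v : HeightOneSpectrum (𝓞 ↥(maximalRealSubfield L)), νG v (UnitaryGroup.cmLocalIntegralLevel L 3 H v : Set (GpLocal L H v)) = 1)
    (hνH : ∀ v, (νH v).IsHaarMeasure)
    (hKH : ∀ v : HeightOneSpectrum (𝓞 ↥(maximalRealSubfield L)),
      νH v (((UnitaryGroup.cmLocalIntegralLevel L 2 (Matrix.of fun i j : Fin 2 => if i.val + j.val + 1 = 2 then (1 : L) else 0) v).prod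
          (UnitaryGroup.cmLocalIntegralLevel L 1 (Matrix.of fun i j : Fin 1 => if i.val + j.val + 1 = 1 then (1 : L) else 0) v) :
            Subgroup (HLocal L v)) : Set (HLocal L v)) = 1)
    (ha : 𝔨.SimpleTraceFormula) :
    ∀ (f' : TestGp L H) (f : TestG L) (fH : TestH L), 𝔨.Smooth f' → 𝔨.Matches f' f fH →
      𝔨.traceGp f' = 𝔨.SJGtot f + (1 / 2 : ℂ) * 𝔨.SJHtot fH := by
  intro f' f fH _ hm
  rw [(ha f').2]
  exact (ComparisonKit.IsPinned.ellipticStabilisation 𝔨 h hanis hherm hνG hK hνH hKH ha f' f fH hm).2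

end ArthurSimplePinned

end Summit.HodgeConjecture.HodgeConjecture.R90.S6

end
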